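import Summits.ResolutionOfSingularities.ResolutionOfSingularities.Theorems.FrobeniusClosingSteerOddBranchParity
import Summits.ResolutionOfSingularities.ResolutionOfSingularities.Theorems.FrobeniusClosingSteerSwitchPlaneChart
import Mathlib.RingTheory.MvPolynomial.Homogeneous
import HarnessLib

/-!
# Crux `Steer` (stmt-ResolutionOfSingularities-16345), chain W4.1, (Par-S) ARITH-REDUCTION — BRICK #2:
# (R1)-LEGALITY «a κ-LINEAR FACTOR of the binary cone gives a σ_top-PERMISSIBLE CENTRE at the next stage»
# (Theses-free, def-free research support)

OURS (campaign `res-hironaka`, rung L ★L-G4, slot W4.1; statements about the route's own objects; they replace the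
role of no printed item and are NOT statements of the manuscript under review [claim: Hironaka2017, status:
under-review]; AI review is weaker than expert review). Seat res-D-pv-003 (gen 6) on res-L0-w41-plan-1 RULING 115a /
116e / 118c («pv-003 #2 = (R1) LEGALITY CRITERION»); author of the criterion: res-L0-w41-tri-1 g5, TRIAGE v6.10 (C7-add)
(R1) and `v610/LinearFactorLegality.lean` (§1 below is tri-1's text, generalised to a square part `g²`); idea-1 g8's laws
(R1)/(R2)/(R4) behind it. Consumer: the ARITH-REDUCTION word `StrippingTailSwitchingArithTwoN` of res-L0-w41-strat-2's
§σ2.28 (g) (tri-1's A7 clause `ArithBinaryResidueAt` VERBATIM), kernel hand res-type-062.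

## What (R1) says and how it is used

At an A-stage `S` (a POINT step of the steered run, exceptional parameter `u`) the cleaned radicand is
`F = s^p − g² ≡ Ψ(m₁, m₂) (mod 𝔪_S^{d+1})` with `Ψ` a BINARY form of degree `d` over `S` and `(m₁, m₂)` part of a regular
system of parameters. In the transform `R` (the next stage `B₁`, centre of `O` ON THE AXIS `V(m₁/u, m₂/u)` of the cone —
`v(m₁), v(m₂) < v(u)`), after the strips the radicand is `f = h² + u·c·G̃` with `c` a unit and `G̃ = F/u^d ≡ Ψ(m₁/u, m₂/u)
(mod u)`. **If the residue form `Ψ̄` has a zero `(ā, b̄) ≠ 0` in `κ_S²` (⟺ a `κ_S`-LINEAR FACTOR), then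
`Q = (u, (b m₁ − a m₂)/u)` is a σ_top-PERMISSIBLE CENTRE of `T² = f` at `R`** (given the post-strip context N4: no
singular prime of height `0` or `1`), so `B₁` is NOT a point step. Contrapositively — the form the reduction uses — a
point step at `B₁` forces `Ψ̄` to have NO non-trivial `κ_S`-zero: the last clause of `ArithBinaryResidueAt`.

## Contents

* §1 (R1-a) σ_top core `isPermissibleCentre_of_linearFactor` (tri-1): `f = g² + u·G`, `G ∈ (u, ℓ)`, `(u, ℓ)` part of a
  regular system of parameters, N4, `dim ≥ 3` ⇒ `(u, ℓ)` permissible (res-D-pv-004's `isSingPrime_of_mem` +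
  `isPermissibleCentre_two_iff_of_height_two` + `OddBranchParity.span_pair_of_isRsopPart`).
* §2 NO FACTOR THEOREM NEEDED: for a homogeneous `Ψ` over ANY commutative ring, a zero `(a, b)` modulo an ideal `I`
  with `a` or `b` a unit gives `Ψ(x, y) ∈ I + (b x − a y)` for ALL `x, y` (`eval_pair_mem_sup_span_of_zero`; `x ≡ b⁻¹a·y`
  modulo `b x − a y` and homogeneity `Ψ(λa, λb) = λ^d Ψ(a, b)`); lifting a residue zero (`exists_lift_of_residue_zero`).
* §3 `IsRsopPart` plumbing: same span ⇒ same property (`IsRsopPart.of_span_range_eq`); `(u, x, y) ⇒ (u, b x − a y)` for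
  `b` (or `a`) a unit; the CONS lemma `isRsopPart_cons_of_not_mem_sq_sup` (`x ∉ 𝔪² + (z)` ⇒ `(x, z)` is again part of a
  regular system of parameters; res-type-062's `SwitchPlane.isRsopPart_pair` is the case `n = 1`).
* PART 2 (`…FrobeniusClosingSteerOddBranchResidueZero.lean`, the split is the 400-line rule): §4 the ON-AXIS transport
  `(u, m₁/u, m₂/u)` part of a regular system of parameters of `R`; §5 division `F/u^d ≡ Ψ(m₁/u, m₂/u) (mod u)`; §6 the
  ASSEMBLY `exists_isPermissibleCentre_of_residue_zero` / `not_forall_not_isPermissibleCentre_of_residue_zero`.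

The strip bookkeeping `f = h² + u·c·F/u^d` ((R0)) and the run-level threading are the assembler's. No Theses file is
imported; nothing here is a route item or a registration. [cite: Matsumura1987, Thm. 14.2] [cite: DeJong1996, 2.4]
[cite: HeinzerEtAl2015, Lemma 2.7] [cite: NovacoskiSpivakovsky2014, Def. 2.11]
-/

noncomputable section

-- `Summit.<S>.<S>.…` duplicates the summit name by design (single-problem summit).
set_option linter.dupNamespace false

open IsLocalRing MvPolynomial

namespace Summit.ResolutionOfSingularities.ResolutionOfSingularities.Theorems.SwitchingDichotomy.OddBranchParity

open Literature.AlgebraicGeometry.Resolution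
open SigmaTopLegality

/-! ## §1 (R1-a) A linear factor of the cone through the centre gives a permissible centre (res-L0-w41-tri-1) -/

section Legality

variable {K : Type} [Field K] [CharP K 2]

/-- **(R1-a) `isPermissibleCentre_of_linearFactor`** (res-L0-w41-tri-1 g5, TRIAGE v6.10 BRICK #2, `v610/LinearFactorLegality.lean`,
with a square part). On a regular local member `R ⊆ K` of characteristic `2` and dimension `c ≥ 3`: if the radicand is
`f = g² + u·G` with `G ∈ (u, ℓ)` and `(u, ℓ)` part of a regular system of parameters (the ODD exceptional divisor `V(u)`
and the hyperplane `V(ℓ)` of a LINEAR FACTOR of the cone), and `T² = f` has no singular prime of height `0` or `1` (the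
post-strip situation N4, hypotheses `h0`/`h1`, NOT discharged here), then `(u, ℓ)` is a σ_top-PERMISSIBLE CENTRE.
[cite: Matsumura1987, Thm. 14.2] -/
theorem isPermissibleCentre_of_linearFactor (R : Subring K) [IsRegularLocalRing R] (f g u ℓ G : R)
    (hc : IsRsopPart ![u, ℓ]) (hf : f = g ^ 2 + u * G) (hG : G ∈ Ideal.span ({u, ℓ} : Set R))
    (h0 : ∀ (P : Ideal R) [P.IsPrime], P.height = 0 → ¬ IsSingPrime R 2 f P)
    (h1 : ∀ (P : Ideal R) [P.IsPrime], P.height = 1 → ¬ IsSingPrime R 2 f P)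
    {c : ℕ} (hc3 : 3 ≤ c) (hdim : ringKrullDim R = c) :
    IsPermissibleCentre R 2 f (Ideal.span ({u, ℓ} : Set R)) := by
  obtain ⟨hprime, hreg, h2, -⟩ := span_pair_of_isRsopPart R hc
  haveI := hprime
  have hu : u ∈ Ideal.span ({u, ℓ} : Set R) := Ideal.subset_span (by simp)
  have hsing : IsSingPrime R 2 f (Ideal.span ({u, ℓ} : Set R)) := isSingPrime_of_mem R f g u G hf _ hu hG
  have hne := span_pair_ne_maximalIdeal_of_isRsopPart R hc hc3 hdim
  exact (isPermissibleCentre_two_iff_of_height_two R f h0 h1 _ hsing h2 hne).mpr hreg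

/-- Hence σ_top's point-step clause `∀ Q, ¬ IsPermissibleCentre R 2 f Q` FAILS. [cite: Matsumura1987, Thm. 14.2] -/
theorem not_forall_not_isPermissibleCentre_of_linearFactor (R : Subring K) [IsRegularLocalRing R] (f g u ℓ G : R)
    (hc : IsRsopPart ![u, ℓ]) (hf : f = g ^ 2 + u * G) (hG : G ∈ Ideal.span ({u, ℓ} : Set R))
    (h0 : ∀ (P : Ideal R) [P.IsPrime], P.height = 0 → ¬ IsSingPrime R 2 f P)
    (h1 : ∀ (P : Ideal R) [P.IsPrime], P.height = 1 → ¬ IsSingPrime R 2 f P)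
    {c : ℕ} (hc3 : 3 ≤ c) (hdim : ringKrullDim R = c) :
    ¬ ∀ Q : Ideal R, ¬ IsPermissibleCentre R 2 f Q := fun h =>
  h _ (isPermissibleCentre_of_linearFactor R f g u ℓ G hc hf hG h0 h1 hc3 hdim)

end Legality

/-! ## §2 Homogeneous forms: scaling, congruences, and the residue zero acting without a factor theorem -/

section Homogeneous

variable {σ A : Type*} [CommRing A]

/-- The exponents of a monomial in the support of a homogeneous polynomial of degree `m` sum to `m`. [folklore] -/
theorem IsHomogeneous.sum_support_eq {φ : MvPolynomial σ A} {m : ℕ} (hφ : φ.IsHomogeneous m) (e : σ →₀ ℕ)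
    (he : coeff e φ ≠ 0) : ∑ i ∈ e.support, e i = m := by
  have h := hφ he
  rw [Finsupp.weight_apply, Finsupp.sum] at h
  simpa using h

/-- **Scaling**: `Ψ(c·x) = c^m · Ψ(x)` for `Ψ` homogeneous of degree `m`. [folklore] -/
theorem IsHomogeneous.eval_mul_left {φ : MvPolynomial σ A} {m : ℕ} (hφ : φ.IsHomogeneous m) (c : A) (x : σ → A) :
    eval (fun i => c * x i) φ = c ^ m * eval x φ := by
  classical
  rw [MvPolynomial.eval_eq, MvPolynomial.eval_eq, Finset.mul_sum]
  refine Finset.sum_congr rfl fun e he => ?_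
  have hdeg : ∑ i ∈ e.support, e i = m := IsHomogeneous.sum_support_eq hφ e (mem_support_iff.mp he)
  have hprod : (∏ i ∈ e.support, (c * x i) ^ (e i)) = c ^ m * ∏ i ∈ e.support, x i ^ (e i) := by
    rw [← hdeg, ← Finset.prod_pow_eq_pow_sum, ← Finset.prod_mul_distrib]
    exact Finset.prod_congr rfl fun i _ => mul_pow c (x i) (e i)
  rw [hprod]
  ring

/-- A homogeneous polynomial of degree `m` evaluated at elements of an ideal `J` lies in `J ^ m`. [folklore] -/
theorem IsHomogeneous.eval_mem_pow {φ : MvPolynomial σ A} {m : ℕ} (hφ : φ.IsHomogeneous m) {J : Ideal A}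
    {x : σ → A} (hx : ∀ i, x i ∈ J) : eval x φ ∈ J ^ m := by
  classical
  rw [MvPolynomial.eval_eq]
  refine Ideal.sum_mem _ fun e he => Ideal.mul_mem_left _ _ ?_
  rw [← IsHomogeneous.sum_support_eq hφ e (mem_support_iff.mp he), ← Finset.prod_pow_eq_pow_sum]
  exact Ideal.prod_mem_prod fun i _ => Ideal.pow_mem_pow (hx i) _

/-- **Congruence**: polynomial values agree modulo an ideal containing the differences of the arguments. [folklore] -/
theorem eval_sub_eval_mem (I : Ideal A) {x y : σ → A} (h : ∀ i, x i - y i ∈ I) (Ψ : MvPolynomial σ A) :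
    eval x Ψ - eval y Ψ ∈ I := by
  rw [← Ideal.Quotient.eq_zero_iff_mem, map_sub, sub_eq_zero]
  change Ideal.Quotient.mk I (eval₂ (RingHom.id A) x Ψ) = Ideal.Quotient.mk I (eval₂ (RingHom.id A) y Ψ)
  rw [MvPolynomial.eval₂_comp_left, MvPolynomial.eval₂_comp_left]
  congr 1
  funext i
  exact Ideal.Quotient.eq.mpr (h i)

/-- **The residue zero acts directly** (no factor theorem for binary forms needed). For `Ψ` homogeneous in two
variables over any commutative ring, a zero `(a, b)` modulo `I` with `b` a UNIT gives, for all `x, y`,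
`Ψ(x, y) ∈ I + (b·x − a·y)`: modulo `ℓ = b x − a y` one has `x ≡ b⁻¹a·y`, so `Ψ(x, y) ≡ Ψ(b⁻¹y·a, b⁻¹y·b) = (b⁻¹y)^d Ψ(a, b)`.
[folklore] -/
theorem eval_pair_mem_sup_span_of_zero_right (Ψ : MvPolynomial (Fin 2) A) {d : ℕ} (hΨ : Ψ.IsHomogeneous d)
    {a b : A} (hb : IsUnit b) {I : Ideal A} (hzero : eval ![a, b] Ψ ∈ I) (x y : A) :
    eval ![x, y] Ψ ∈ I ⊔ Ideal.span {b * x - a * y} := by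
  obtain ⟨b', hb'⟩ := hb.exists_left_inv
  -- `Ψ(x, y) − Ψ((b'y)a, (b'y)b) ∈ (ℓ)`
  have hcong : eval ![x, y] Ψ - eval (fun i => (b' * y) * ![a, b] i) Ψ ∈ Ideal.span {b * x - a * y} := by
    refine eval_sub_eval_mem _ (fun i => ?_) Ψ
    fin_cases i
    · change x - b' * y * a ∈ Ideal.span {b * x - a * y}
      refine Ideal.mem_span_singleton'.mpr ⟨b', ?_⟩
      linear_combination (x : A) * hb'
    · change y - b' * y * b ∈ Ideal.span {b * x - a * y}
      have : y - b' * y * b = 0 := by linear_combination (-(y : A)) * hb'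
      rw [this]
      exact Ideal.zero_mem _
  have hscal : eval (fun i => (b' * y) * ![a, b] i) Ψ = (b' * y) ^ d * eval ![a, b] Ψ :=
    IsHomogeneous.eval_mul_left hΨ _ _
  have hmem : eval (fun i => (b' * y) * ![a, b] i) Ψ ∈ I := by
    rw [hscal]
    exact Ideal.mul_mem_left _ _ hzero
  have : eval ![x, y] Ψ = (eval ![x, y] Ψ - eval (fun i => (b' * y) * ![a, b] i) Ψ) +
      eval (fun i => (b' * y) * ![a, b] i) Ψ := by ring
  rw [this]
  exact Ideal.add_mem _ (Ideal.mem_sup_right hcong) (Ideal.mem_sup_left hmem)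

/-- The same with `a` a unit (then `y ≡ a⁻¹b·x` modulo `b x − a y`). [folklore] -/
theorem eval_pair_mem_sup_span_of_zero_left (Ψ : MvPolynomial (Fin 2) A) {d : ℕ} (hΨ : Ψ.IsHomogeneous d)
    {a b : A} (ha : IsUnit a) {I : Ideal A} (hzero : eval ![a, b] Ψ ∈ I) (x y : A) :
    eval ![x, y] Ψ ∈ I ⊔ Ideal.span {b * x - a * y} := by
  obtain ⟨a', ha'⟩ := ha.exists_left_inv
  have hcong : eval ![x, y] Ψ - eval (fun i => (a' * x) * ![a, b] i) Ψ ∈ Ideal.span {b * x - a * y} := by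
    refine eval_sub_eval_mem _ (fun i => ?_) Ψ
    fin_cases i
    · change x - a' * x * a ∈ Ideal.span {b * x - a * y}
      have : x - a' * x * a = 0 := by linear_combination (-(x : A)) * ha'
      rw [this]
      exact Ideal.zero_mem _
    · change y - a' * x * b ∈ Ideal.span {b * x - a * y}
      refine Ideal.mem_span_singleton'.mpr ⟨-a', ?_⟩
      linear_combination (y : A) * ha'
  have hscal : eval (fun i => (a' * x) * ![a, b] i) Ψ = (a' * x) ^ d * eval ![a, b] Ψ :=
    IsHomogeneous.eval_mul_left hΨ _ _
  have hmem : eval (fun i => (a' * x) * ![a, b] i) Ψ ∈ I := by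
    rw [hscal]
    exact Ideal.mul_mem_left _ _ hzero
  have : eval ![x, y] Ψ = (eval ![x, y] Ψ - eval (fun i => (a' * x) * ![a, b] i) Ψ) +
      eval (fun i => (a' * x) * ![a, b] i) Ψ := by ring
  rw [this]
  exact Ideal.add_mem _ (Ideal.mem_sup_right hcong) (Ideal.mem_sup_left hmem)

/-- **`eval_pair_mem_sup_span_of_zero`**: either coordinate of the zero a unit. [folklore] -/
theorem eval_pair_mem_sup_span_of_zero (Ψ : MvPolynomial (Fin 2) A) {d : ℕ} (hΨ : Ψ.IsHomogeneous d)
    {a b : A} (hab : IsUnit a ∨ IsUnit b) {I : Ideal A} (hzero : eval ![a, b] Ψ ∈ I) (x y : A) :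
    eval ![x, y] Ψ ∈ I ⊔ Ideal.span {b * x - a * y} := by
  rcases hab with ha | hb
  · exact eval_pair_mem_sup_span_of_zero_left Ψ hΨ ha hzero x y
  · exact eval_pair_mem_sup_span_of_zero_right Ψ hΨ hb hzero x y

/-- **Lifting a residue zero**: for a local ring `A`, a zero `(ā, b̄) ≠ 0` of the residue form `Ψ̄` over `κ_A` (the
NEGATION of `ArithBinaryResidueAt`'s last clause) lifts to `a, b ∈ A`, one of them a unit, with `Ψ(a, b) ∈ 𝔪_A`.
[folklore] -/
theorem exists_lift_of_residue_zero [IsLocalRing A] (Ψ : MvPolynomial (Fin 2) A)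
    (h : ∃ a b : ResidueField A, (a ≠ 0 ∨ b ≠ 0) ∧ eval ![a, b] (map (residue A) Ψ) = 0) :
    ∃ a b : A, (IsUnit a ∨ IsUnit b) ∧ eval ![a, b] Ψ ∈ maximalIdeal A := by
  obtain ⟨abar, bbar, hne, hzero⟩ := h
  obtain ⟨a, rfl⟩ := residue_surjective abar
  obtain ⟨b, rfl⟩ := residue_surjective bbar
  refine ⟨a, b, ?_, ?_⟩
  · rcases hne with ha | hb
    · exact Or.inl (by rwa [Ne, residue_eq_zero_iff, IsLocalRing.mem_maximalIdeal, mem_nonunits_iff, not_not] at ha)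
    · exact Or.inr (by rwa [Ne, residue_eq_zero_iff, IsLocalRing.mem_maximalIdeal, mem_nonunits_iff, not_not] at hb)
  · rw [← residue_eq_zero_iff]
    have hcomm : residue A (eval ![a, b] Ψ) = eval ![residue A a, residue A b] (map (residue A) Ψ) := by
      rw [MvPolynomial.eval_map]
      change residue A (eval₂ (RingHom.id A) ![a, b] Ψ) = _
      rw [MvPolynomial.eval₂_comp_left]
      congr 1
      funext i
      fin_cases i <;> rfl
    rw [hcomm, hzero]

end Homogeneous

/-! ## §3 `IsRsopPart` plumbing -/

section Rsop

variable {A : Type*} [CommRing A] [IsLocalRing A]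

/-- Being part of a regular system of parameters depends only on the ideal spanned (for families of the same length).
[folklore] -/
theorem IsRsopPart.of_span_range_eq {n : ℕ} {z z' : Fin n → A} (hz : IsRsopPart z)
    (h : Ideal.span (Set.range z') = Ideal.span (Set.range z)) : IsRsopPart z' := by
  obtain ⟨hR, e, y, hdim, hspan⟩ := hz
  refine ⟨hR, e, y, hdim, ?_⟩
  rw [Ideal.span_union] at hspan ⊢
  rw [h]
  exact hspan

/-- From `(u, x, y)` part of a regular system of parameters and `b` a UNIT: `(u, b·x − a·y, y)` is one (same span).
[folklore] -/
theorem isRsopPart_triple_lin (u x y a b : A) (h : IsRsopPart ![u, x, y]) (hb : IsUnit b) :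
    IsRsopPart ![u, b * x - a * y, y] := by
  refine IsRsopPart.of_span_range_eq h ?_
  obtain ⟨b', hb'⟩ := hb.exists_left_inv
  apply le_antisymm
  · rw [Ideal.span_le]
    rintro _ ⟨i, rfl⟩
    fin_cases i
    · exact Ideal.subset_span ⟨0, rfl⟩
    · change b * x - a * y ∈ Ideal.span (Set.range ![u, x, y])
      exact Ideal.sub_mem _ (Ideal.mul_mem_left _ _ (Ideal.subset_span ⟨1, rfl⟩))
        (Ideal.mul_mem_left _ _ (Ideal.subset_span ⟨2, rfl⟩))
    · exact Ideal.subset_span ⟨2, rfl⟩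
  · rw [Ideal.span_le]
    rintro _ ⟨i, rfl⟩
    fin_cases i
    · exact Ideal.subset_span ⟨0, rfl⟩
    · change x ∈ Ideal.span (Set.range ![u, b * x - a * y, y])
      have hx : x = b' * (b * x - a * y) + (b' * a) * y := by linear_combination (-(x : A)) * hb'
      have hmem : b' * (b * x - a * y) + (b' * a) * y ∈ Ideal.span (Set.range ![u, b * x - a * y, y]) :=
        Ideal.add_mem _ (Ideal.mul_mem_left _ _ (Ideal.subset_span ⟨1, rfl⟩))
          (Ideal.mul_mem_left _ _ (Ideal.subset_span ⟨2, rfl⟩))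
      rwa [← hx] at hmem
    · exact Ideal.subset_span ⟨2, rfl⟩

/-- From `(u, x, y)` part of a regular system of parameters and `a` a UNIT: `(u, x, b·x − a·y)` is one (same span).
[folklore] -/
theorem isRsopPart_triple_lin' (u x y a b : A) (h : IsRsopPart ![u, x, y]) (ha : IsUnit a) :
    IsRsopPart ![u, x, b * x - a * y] := by
  refine IsRsopPart.of_span_range_eq h ?_
  obtain ⟨a', ha'⟩ := ha.exists_left_inv
  apply le_antisymm
  · rw [Ideal.span_le]
    rintro _ ⟨i, rfl⟩
    fin_cases i
    · exact Ideal.subset_span ⟨0, rfl⟩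
    · exact Ideal.subset_span ⟨1, rfl⟩
    · change b * x - a * y ∈ Ideal.span (Set.range ![u, x, y])
      exact Ideal.sub_mem _ (Ideal.mul_mem_left _ _ (Ideal.subset_span ⟨1, rfl⟩))
        (Ideal.mul_mem_left _ _ (Ideal.subset_span ⟨2, rfl⟩))
  · rw [Ideal.span_le]
    rintro _ ⟨i, rfl⟩
    fin_cases i
    · exact Ideal.subset_span ⟨0, rfl⟩
    · exact Ideal.subset_span ⟨1, rfl⟩
    · change y ∈ Ideal.span (Set.range ![u, x, b * x - a * y])
      have hy : y = (a' * b) * x - a' * (b * x - a * y) := by linear_combination (-(y : A)) * ha'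
      have hmem : (a' * b) * x - a' * (b * x - a * y) ∈ Ideal.span (Set.range ![u, x, b * x - a * y]) :=
        Ideal.sub_mem _ (Ideal.mul_mem_left _ _ (Ideal.subset_span ⟨1, rfl⟩))
          (Ideal.mul_mem_left _ _ (Ideal.subset_span ⟨2, rfl⟩))
      rwa [← hy] at hmem

/-- **`(u, x, y)` part of a regular system of parameters, `a` or `b` a unit ⇒ `(u, b·x − a·y)` is one.** [folklore] -/
theorem isRsopPart_pair_lin_of_triple (u x y a b : A) (h : IsRsopPart ![u, x, y]) (hab : IsUnit a ∨ IsUnit b) :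
    IsRsopPart ![u, b * x - a * y] := by
  rcases hab with ha | hb
  · have h3 := isRsopPart_triple_lin' u x y a b h ha
    have h2 := h3.comp ![0, 2] (by decide)
    convert h2 using 1
    funext i
    fin_cases i <;> rfl
  · have h3 := isRsopPart_triple_lin u x y a b h hb
    have h2 := h3.comp ![0, 1] (by decide)
    convert h2 using 1
    funext i
    fin_cases i <;> rfl

end Rsop

section Cons

variable {A : Type*} [CommRing A] [IsRegularLocalRing A]

/-- **CONS lemma.** In a regular local ring, if `z` is part of a regular system of parameters and
`x ∈ 𝔪 ∖ (𝔪² + (z))`, then `(x, z)` is part of a regular system of parameters: `A/(z)` is regular of dimension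
`dim A − n`, the class of `x` is a regular parameter there, so `A/(x, z) ≅ (A/(z))/(x̄)` is regular of dimension
`dim A − n − 1` (Matsumura 14.2 and the Remark after it). res-type-062's `SwitchPlane.isRsopPart_pair` is `n = 1`.
[cite: Matsumura1987, Thm. 14.2] -/
theorem isRsopPart_cons_of_not_mem_sq_sup {n : ℕ} {z : Fin n → A} (hz : IsRsopPart z)
    {x : A} (hx : x ∈ maximalIdeal A) (hx2 : x ∉ maximalIdeal A ^ 2 ⊔ Ideal.span (Set.range z)) :
    IsRsopPart (Matrix.vecCons x z) := by
  classical
  set I : Ideal A := Ideal.span (Set.range z) with hI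
  haveI hregI : IsRegularLocalRing (A ⧸ I) := hz.isRegularLocalRing_quotient
  have hdimI := hz.ringKrullDim_quotient_add
  haveI : Nontrivial (A ⧸ I) := Ideal.Quotient.nontrivial_iff.mpr hz.span_range_ne_top
  -- the class of `x` in `A/I`
  have hxbar : Ideal.Quotient.mk I x ∈ maximalIdeal (A ⧸ I) := by
    rw [maximalIdeal_quotient_eq_map I]
    exact Ideal.mem_map_of_mem _ hx
  have hxbar2 : Ideal.Quotient.mk I x ∉ maximalIdeal (A ⧸ I) ^ 2 := by
    rw [maximalIdeal_quotient_eq_map I, ← Ideal.map_pow, Ideal.mem_map_iff_of_surjective _ Ideal.Quotient.mk_surjective]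
    rintro ⟨y, hy, hyx⟩
    rw [Ideal.Quotient.eq] at hyx
    apply hx2
    have hxy : x = y - (y - x) := by ring
    rw [hxy]
    exact Ideal.sub_mem _ (Ideal.mem_sup_left hy) (Ideal.mem_sup_right hyx)
  obtain ⟨hreg2, hdim2⟩ := IsRegularLocalRing.quotient_span_singleton hxbar hxbar2
  haveI := hreg2
  -- `A/(x, z) ≅ (A/I)/(x̄)`
  have hsup : I ⊔ Ideal.span {x} = Ideal.span (Set.range (Matrix.vecCons x z)) := by
    rw [Matrix.range_cons, Ideal.span_union, sup_comm]
  have hmap : (Ideal.span {x}).map (Ideal.Quotient.mk I) = Ideal.span {Ideal.Quotient.mk I x} := by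
    rw [Ideal.map_span, Set.image_singleton]
  let e : (A ⧸ I) ⧸ Ideal.span {Ideal.Quotient.mk I x} ≃+* A ⧸ Ideal.span (Set.range (Matrix.vecCons x z)) :=
    (Ideal.quotEquivOfEq hmap.symm).trans
      ((DoubleQuot.quotQuotEquivQuotSup I (Ideal.span {x})).trans (Ideal.quotEquivOfEq hsup))
  haveI : IsRegularLocalRing (A ⧸ Ideal.span (Set.range (Matrix.vecCons x z))) := IsRegularLocalRing.of_ringEquiv e
  refine IsRsopPart.of_isRegularLocalRing_quotient (fun i => ?_) ?_
  · refine Fin.cases ?_ (fun j => ?_) i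
    · exact hx
    · simpa using hz.mem_maximalIdeal j
  · rw [← ringKrullDim_eq_of_ringEquiv e, ← hdimI, ← hdim2, Nat.cast_succ, add_assoc, add_comm (1 : WithBot ℕ∞)]

end Cons

end Summit.ResolutionOfSingularities.ResolutionOfSingularities.Theorems.SwitchingDichotomy.OddBranchParity

end
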